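import Literature.AlgebraicGeometry.Frobenioids.DirectSumMonoids
import Literature.AlgebraicGeometry.Frobenioids.PerfectionPrimes
import Literature.AnabelianGeometry.EtaleTheta.PerfectionPrimes
import HarnessLib

/-!
# [FrdI] §0 / Def. 2.4 (i) for the full direct PRODUCT `∏_J ℤ≥0`: sharp, divisorial, primes = coordinates,
# monoprime prime components — and [EtTh] Prop 3.2 (i)'s `DIV⁺(Z_∞^log)`

Mochizuki, *The geometry of Frobenioids I*, Kyushu J. Math. **62** (2008), §0 pp.11–12 (sharp, integral,
saturated, `≼`, primary, primes, `M_𝔭`, monoprime) and Def. 2.4 (i) p.47 [cite: MochizukiFrdI2008, §0 p.12];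
Mochizuki, *The étale theta function …*, Publ. RIMS **45** (2009), Prop. 3.2 (i), PDF p.70
[cite: MochizukiEtTh2009, Prop 3.2 p.70]: the monoid `DIV⁺(Z_∞^log)` of effective log-divisors on the universal
combinatorial covering is "indexed by the cusps … and irreducible components of the special fiber of
`Z_∞^log`" — for the infinite chain a FULL PRODUCT `∏_J ℤ≥0` over a countably infinite `J` (locally finite
sums are automatic), not a direct sum.

abc-iut cell, finding F-L2d2-1 (seat abc-iut-L2-d2): the companion `PerfFactorialProductCounterexample.lean`
shows that clause (d) of Def. 2.4 (i) FAILS for `∏_ℕ ℤ≥0`; this file and its sequel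
`PiNatFactorization.lean` prove everything else of Def. 2.4 (i) for `M_J := Multiplicative (J → ℕ)` —
here the §0 structure: pointwise divisibility, sharp, cancellative, DIVISORIAL (via abc-iut-L1-d2's criterion
`isDivisorial_of_dvd_of_pow`), the primary elements are the coordinate vectors `e_j^k` (`k ≠ 0`), the primes
are the coordinates (`primesEquiv : J ≃ Primes M_J`), and every prime component `(M_J)_𝔭 ≅ ℤ≥0` is
monoprime (clause (b)); hence (L1 `isMonoprime_submonoid_primes_perfection`) every `(M_J^pf)_𝔮` is monoprime.
These are the structure-independent inputs of the positive instance of the repaired notion (finding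
F-L2d2-1, clause (d♮) "integral patterns").  Multiplicative notation; `coeff f j` is the exponent of `f` at `j`.
HONEST FRAMING: classical monoid algebra; nothing here bears on [IUTchIII] Cor. 3.12.
-/

namespace Literature.AlgebraicGeometry.Frobenioids

namespace PiNat

open Function Literature.AnabelianGeometry.EtaleTheta

universe u

variable {J : Type u}

/-! ### Coordinates -/

/-- The exponent of `f ∈ ∏_J ℤ≥0` at the coordinate `j`. [cite: MochizukiFrdI2008, §0 p.11] -/
abbrev coeff (f : Multiplicative (J → ℕ)) (j : J) : ℕ := Multiplicative.toAdd f j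

/-- Two elements with the same exponents are equal. [cite: MochizukiFrdI2008, §0 p.11] -/
theorem ext {f g : Multiplicative (J → ℕ)} (h : ∀ j, coeff f j = coeff g j) : f = g :=
  Multiplicative.toAdd.injective (funext h)

/-- Exponents of a product. [cite: MochizukiFrdI2008, §0 p.11] -/
@[simp] theorem coeff_mul (f g : Multiplicative (J → ℕ)) (j : J) : coeff (f * g) j = coeff f j + coeff g j :=
  rfl

/-- Exponents of `1`. [cite: MochizukiFrdI2008, §0 p.11] -/
@[simp] theorem coeff_one (j : J) : coeff (1 : Multiplicative (J → ℕ)) j = 0 := rfl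

/-- Exponents of a power. [cite: MochizukiFrdI2008, §0 p.11] -/
@[simp] theorem coeff_pow (f : Multiplicative (J → ℕ)) (n : ℕ) (j : J) : coeff (f ^ n) j = n * coeff f j := by
  induction n with
  | zero => simp
  | succ n ih => rw [pow_succ, coeff_mul, ih]; ring

/-- **Divisibility in `∏_J ℤ≥0` is the pointwise order of exponents.** [cite: MochizukiFrdI2008, §0 p.12] -/
theorem dvd_iff {f g : Multiplicative (J → ℕ)} : f ∣ g ↔ ∀ j, coeff f j ≤ coeff g j := by
  constructor
  · rintro ⟨h, rfl⟩ j
    rw [coeff_mul]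
    exact Nat.le_add_right _ _
  · intro hfg
    refine ⟨Multiplicative.ofAdd (fun j => coeff g j - coeff f j), ext fun j => ?_⟩
    change coeff g j = coeff f j + (coeff g j - coeff f j)
    exact (Nat.add_sub_cancel' (hfg j)).symm

/-! ### Sharp, cancellative, divisorial -/

/-- `∏_J ℤ≥0` is sharp. [cite: MochizukiFrdI2008, §0 p.11] -/
theorem isSharp : IsSharp (Multiplicative (J → ℕ)) := by
  refine ⟨fun x hx => ?_⟩
  obtain ⟨y, hy⟩ := hx.exists_right_inv
  exact ext fun j => by
    have := congrArg (fun f => coeff f j) hy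
    simp only [coeff_mul, coeff_one] at this
    rw [coeff_one]
    omega

/-- **`∏_J ℤ≥0` is divisorial** (integral, saturated, of characteristic type, sharp): by abc-iut-L1-d2's
criterion — `a^n = c · b^n` forces `b ≤ a` coordinatewise. [cite: MochizukiFrdI2008, §0 p.11] -/
theorem isDivisorial : IsDivisorial (Multiplicative (J → ℕ)) := by
  refine isDivisorial_of_dvd_of_pow isSharp fun a b c n hn h => dvd_iff.2 fun j => ?_
  have := congrArg (fun f => coeff f j) h
  simp only [coeff_pow, coeff_mul] at this
  nlinarith [this, Nat.zero_le (coeff c j)]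

/-! ### Coordinate vectors (need decidable equality on `J`) -/

variable [DecidableEq J]

/-- The coordinate vector `e_j^k`. [cite: MochizukiFrdI2008, §0 p.12] -/
def single (j : J) (k : ℕ) : Multiplicative (J → ℕ) := Multiplicative.ofAdd (Pi.single j k)

/-- Exponents of `e_j^k` at `j`. [cite: MochizukiFrdI2008, §0 p.12] -/
@[simp] theorem coeff_single_same (j : J) (k : ℕ) : coeff (single j k) j = k := by
  simp [coeff, single]

/-- Exponents of `e_j^k` off `j`. [cite: MochizukiFrdI2008, §0 p.12] -/
theorem coeff_single_of_ne {i j : J} (h : i ≠ j) (k : ℕ) : coeff (single j k) i = 0 := by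
  simp [coeff, single, h]

/-- `e_j^0 = 1`. [cite: MochizukiFrdI2008, §0 p.12] -/
@[simp] theorem single_zero (j : J) : single j 0 = 1 :=
  ext fun i => by by_cases h : i = j <;> simp [h, coeff_single_of_ne]

/-- `e_j^k · e_j^l = e_j^{k+l}`. [cite: MochizukiFrdI2008, §0 p.12] -/
theorem single_mul_single (j : J) (k l : ℕ) : single j k * single j l = single j (k + l) :=
  ext fun i => by by_cases h : i = j <;> simp [h, coeff_single_of_ne]

/-- `(e_j^k)^n = e_j^{nk}`. [cite: MochizukiFrdI2008, §0 p.12] -/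
theorem single_pow (j : J) (k n : ℕ) : single j k ^ n = single j (n * k) :=
  ext fun i => by by_cases h : i = j <;> simp [h, coeff_single_of_ne]

/-- `e_j^k = 1 ↔ k = 0`. [cite: MochizukiFrdI2008, §0 p.12] -/
theorem single_eq_one_iff {j : J} {k : ℕ} : single j k = 1 ↔ k = 0 :=
  ⟨fun h => by simpa using congrArg (fun f => coeff f j) h, fun h => by rw [h, single_zero]⟩

/-- An element supported at `j` only is `e_j^{f_j}`. [cite: MochizukiFrdI2008, §0 p.12] -/
theorem eq_single_of_coeff_eq_zero {f : Multiplicative (J → ℕ)} {j : J} (h : ∀ i, i ≠ j → coeff f i = 0) :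
    f = single j (coeff f j) :=
  ext fun i => by
    by_cases hi : i = j
    · subst hi; simp
    · rw [h i hi, coeff_single_of_ne hi]

/-! ### `≼`, primary elements, primes -/

/-- `f ≼ e_j^k` forces `f` to be supported at `j`. [cite: MochizukiFrdI2008, §0 p.12] -/
theorem eq_single_of_precsim_single {f : Multiplicative (J → ℕ)} {j : J} {k : ℕ}
    (h : Precsim f (single j k)) : f = single j (coeff f j) := by
  obtain ⟨n, -, hn⟩ := h
  rw [single_pow, dvd_iff] at hn
  exact eq_single_of_coeff_eq_zero fun i hi => Nat.eq_zero_of_le_zero (by simpa [coeff_single_of_ne hi] using hn i)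

/-- `e_j^k ≼ f` whenever `f_j ≠ 0`. [cite: MochizukiFrdI2008, §0 p.12] -/
theorem single_precsim_of_coeff_ne_zero {f : Multiplicative (J → ℕ)} {j : J} (hf : coeff f j ≠ 0) (k : ℕ) :
    Precsim (single j k) f := by
  refine ⟨k + 1, Nat.succ_pos _, dvd_iff.2 fun i => ?_⟩
  by_cases hi : i = j
  · subst hi
    rw [coeff_single_same, coeff_pow]
    calc k ≤ k + 1 := Nat.le_succ _
      _ = (k + 1) * 1 := (Nat.mul_one _).symm
      _ ≤ (k + 1) * coeff f i := Nat.mul_le_mul_left _ (Nat.one_le_iff_ne_zero.2 hf)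
  · rw [coeff_single_of_ne hi]; exact Nat.zero_le _

/-- `e_j^k ≼ e_j^l` for `l ≠ 0`. [cite: MochizukiFrdI2008, §0 p.12] -/
theorem single_precsim_single (j : J) (k : ℕ) {l : ℕ} (hl : l ≠ 0) : Precsim (single j k) (single j l) :=
  single_precsim_of_coeff_ne_zero (by simpa using hl) k

/-- **The coordinate vectors `e_j^k` (`k ≠ 0`) are primary.** [cite: MochizukiFrdI2008, §0 p.12] -/
theorem isPrimary_single (j : J) {k : ℕ} (hk : k ≠ 0) : IsPrimary (single j k) := by
  refine ⟨fun h => hk (single_eq_one_iff.1 h), fun g hg hgj => ?_⟩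
  have hge := eq_single_of_precsim_single hgj
  have hc : coeff g j ≠ 0 := fun h0 => hg (by rw [hge, h0, single_zero])
  rw [hge]
  exact single_precsim_of_coeff_ne_zero (by simpa using hc) k  -- wait: target Precsim (single j k) (single j (coeff g j))

/-- **Every primary element of `∏_J ℤ≥0` is a coordinate vector `e_j^k`, `k ≠ 0`.**
[cite: MochizukiFrdI2008, §0 p.12] -/
theorem exists_eq_single_of_isPrimary {f : Multiplicative (J → ℕ)} (hf : IsPrimary f) :
    ∃ (j : J) (k : ℕ), k ≠ 0 ∧ f = single j k := by
  -- some coordinate of `f` is nonzero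
  have hne : ∃ j, coeff f j ≠ 0 := by
    by_contra h
    push Not at h
    exact hf.1 (ext fun j => by rw [h j, coeff_one])
  obtain ⟨j, hj⟩ := hne
  -- `e_j ≼ f`, so `f ≼ e_j` by primality, so `f` is supported at `j`
  have h1 : Precsim (single j 1) f := single_precsim_of_coeff_ne_zero hj 1
  have h2 := hf.2 _ (fun h => one_ne_zero (single_eq_one_iff.1 h)) h1
  exact ⟨j, coeff f j, hj, eq_single_of_precsim_single h2⟩

/-- The prime `𝔭_j` of `∏_J ℤ≥0`: the class of `e_j`. [cite: MochizukiFrdI2008, §0 p.12] -/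
def prime (j : J) : Primes (Multiplicative (J → ℕ)) :=
  Quotient.mk (primarySetoid _) ⟨single j 1, isPrimary_single j one_ne_zero⟩

/-- `e_j^k ∈ 𝔭_j` for `k ≠ 0`. [cite: MochizukiFrdI2008, §0 p.12] -/
theorem single_mem_carrier_prime (j : J) {k : ℕ} (hk : k ≠ 0) : single j k ∈ (prime j).carrier :=
  Primes.mem_carrier_of_precsim _ (mem_carrier_mk_of_isPrimary _) (isPrimary_single j hk).1
    (single_precsim_single j k one_ne_zero)

/-- The elements of `𝔭_j` are the `e_j^k`, `k ≠ 0`. [cite: MochizukiFrdI2008, §0 p.12] -/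
theorem mem_carrier_prime_iff {j : J} {f : Multiplicative (J → ℕ)} :
    f ∈ (prime j).carrier ↔ ∃ k, k ≠ 0 ∧ f = single j k := by
  constructor
  · intro hf
    have hfj := Primes.precsim_of_mem_carrier _ hf (single_mem_carrier_prime j one_ne_zero)
    have hge := eq_single_of_precsim_single hfj
    refine ⟨coeff f j, fun h0 => hf.1.1 (by rw [hge, h0, single_zero]), hge⟩
  · rintro ⟨k, hk, rfl⟩
    exact single_mem_carrier_prime j hk

/-- **`j ↦ 𝔭_j` is a bijection `J ≃ Prime(∏_J ℤ≥0)`** — the primes are the coordinates.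
[cite: MochizukiFrdI2008, §0 p.12] -/
theorem prime_bijective : Bijective (prime (J := J)) := by
  constructor
  · intro i j hij
    have h := single_mem_carrier_prime i one_ne_zero
    rw [hij, mem_carrier_prime_iff] at h
    obtain ⟨k, -, hk⟩ := h
    by_contra hne
    have := congrArg (fun f => coeff f i) hk
    rw [coeff_single_same, coeff_single_of_ne hne] at this
    exact one_ne_zero this
  · intro 𝔭
    obtain ⟨⟨f, hf⟩, rfl⟩ := Quotient.exists_rep 𝔭
    obtain ⟨j, k, hk, rfl⟩ := exists_eq_single_of_isPrimary hf
    refine ⟨j, Quotient.sound ?_⟩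
    exact single_precsim_single j 1 hk

/-- `Prime(∏_J ℤ≥0) ≃ J`. [cite: MochizukiFrdI2008, §0 p.12] -/
noncomputable def primesEquiv : J ≃ Primes (Multiplicative (J → ℕ)) := Equiv.ofBijective _ prime_bijective

/-- The elements of the submonoid `(∏_J ℤ≥0)_{𝔭_j}` are exactly the `e_j^k`. [cite: MochizukiFrdI2008, §0 p.12] -/
theorem mem_submonoid_prime_iff {j : J} {f : Multiplicative (J → ℕ)} :
    f ∈ (prime j).submonoid ↔ ∃ k, f = single j k := by
  constructor
  · intro hf
    induction hf using Submonoid.closure_induction with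
    | mem g hg => obtain ⟨k, -, rfl⟩ := mem_carrier_prime_iff.1 hg; exact ⟨k, rfl⟩
    | one => exact ⟨0, (single_zero j).symm⟩
    | mul g g' _ _ hg hg' =>
      obtain ⟨k, rfl⟩ := hg
      obtain ⟨k', rfl⟩ := hg'
      exact ⟨k + k', single_mul_single j k k'⟩
  · rintro ⟨k, rfl⟩
    by_cases hk : k = 0
    · rw [hk, single_zero]; exact one_mem _
    · exact Submonoid.subset_closure (single_mem_carrier_prime j hk)

/-- **Clause (b) of Def. 2.4 (i) for `∏_J ℤ≥0`: every prime component `(∏_J ℤ≥0)_𝔭 ≅ ℤ≥0` is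
(`ℤ`-)monoprime.** [cite: MochizukiFrdI2008, Def. 2.4(i) p.47] -/
theorem isMonoprime_submonoid_prime (𝔭 : Primes (Multiplicative (J → ℕ))) : IsMonoprime ↥𝔭.submonoid := by
  obtain ⟨j, rfl⟩ := prime_bijective.2 𝔭
  refine IsMonoprime.ofZ ⟨⟨MulEquiv.symm ?_⟩⟩
  refine { toFun := fun k => ⟨single j (Multiplicative.toAdd k), mem_submonoid_prime_iff.2 ⟨_, rfl⟩⟩
           invFun := fun f => Multiplicative.ofAdd (coeff f.1 j)
           left_inv := fun k => by simp
           right_inv := fun f => ?_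
           map_mul' := fun k l => Subtype.ext (by simp [single_mul_single]) }
  obtain ⟨k, hk⟩ := mem_submonoid_prime_iff.1 f.2
  apply Subtype.ext
  simp [hk]

/-- Hence every prime component `(∏_J ℤ≥0)^pf_𝔮` of the perfection is monoprime (L1:
`M^pf_𝔮 ≅ (M_𝔭)^pf`). [cite: MochizukiFrdI2008, Def. 2.4(i) p.47] -/
theorem isMonoprime_pfAt (𝔮 : Primes (Perfection (Multiplicative (J → ℕ)))) :
    IsMonoprime (PfAt (Multiplicative (J → ℕ)) 𝔮) :=
  isMonoprime_submonoid_primes_perfection isSharp isMonoprime_submonoid_prime 𝔮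

end PiNat

end Literature.AlgebraicGeometry.Frobenioids
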